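import Mathlib
import Summits.NavierStokesRegularity.NavierStokesRegularity.Theorems.EulerZoomLiouvillePowerGaugeEulerLiouvilleCondenserQuietPlane

/-!
# (Q) THE `s²`-WEIGHTED QUIET SLICE (nsreg-p2 g35 ROUND-45 «RAISING κ» §1, plate t47-Q)

Width piece for crux `EulerZoomLiouville.PowerGaugeEulerLiouville` (stmt-NavierStokesRegularity-19832), by name under LEAD 19832
(ns-typeII-p2 g13); seat ns-ezl-w2 g4, `--supports stmt-NavierStokesRegularity-19832 --as helper`.  Text = nsreg-p2 g35's
`r45/Sketch45.lean` Prop `NsregP2.R45.WeightedQuietSlice` binder-for-binder.  It replaces t42-QP `Condenser.exists_quietPlane`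
(thresholds `4X/R`, `4Y/R` on `[R, 2R]`) by a slice on `[R, ΛR]` whose `G`-budget carries the weight `s²`:

`F, G ≥ 0` continuous, `∫_{B(0,R')} F ≤ X`, `∫_{B(0,R')} G ≤ Y`, `Λ > 1`, `0 < η < 1` ⇒ some height `s ∈ [R, ΛR]` has
`∫ 𝟙_{B(0,R')}F ∘ plane s ≤ X/(η(Λ−1)R)` AND `∫ 𝟙_{B(0,R')}G ∘ plane s ≤ 3Y s²/(((1+(1−η)(Λ−1))³ − 1)R³)`.
Proof: Markov for `F` leaves a good set of heights of measure `≥ (1−η)(Λ−1)R`; if on it every `G`-slice exceeded `λ s²`, then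
`∫ G`-slices `> λ·∫_R^{R+(1−η)(Λ−1)R} s² ds = Y` by the BATHTUB principle for the increasing weight `s²` (`setIntegral_sq_ge_bathtub`).

HONEST FRAMING: measure theory on coordinate slices of `ℝ³`; nothing here proves the crux E (19832 OPEN), any door Target, or any
Navier–Stokes statement; MODEL lattice only. [folklore (Markov, bathtub principle)]
-/

noncomputable section

open Set Filter Topology Metric Function MeasureTheory Real

set_option linter.dupNamespace false

namespace Summit.NavierStokesRegularity.NavierStokesRegularity.Theorems.PowerGaugeEulerLiouville.Condenser

/-! ## The bathtub principle for the weight `s²` -/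

/-- **BATHTUB for `s²`.**  `0 ≤ a`, `0 ≤ μ₀`, `S ⊆ [a, b]` measurable with `vol S ≥ μ₀` and `a + μ₀ ≤ b`:
`∫_{[a, a+μ₀]} s² ≤ ∫_S s²` (the increasing weight is smallest on the leftmost interval of the given length). [folklore] -/
theorem setIntegral_sq_ge_bathtub {S : Set ℝ} {a b μ₀ : ℝ} (ha : 0 ≤ a) (hμ₀ : 0 ≤ μ₀)
    (hS : MeasurableSet S) (hSab : S ⊆ Icc a b) (hvol : μ₀ ≤ volume.real S) :
    ∫ s in Icc a (a + μ₀), s ^ 2 ≤ ∫ s in S, s ^ 2 := by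
  set I : Set ℝ := Icc a (a + μ₀) with hI
  have hIm : MeasurableSet I := measurableSet_Icc
  have hSfin : volume S ≠ ⊤ := (measure_mono hSab |>.trans_lt measure_Icc_lt_top).ne
  have hIfin : volume I ≠ ⊤ := measure_Icc_lt_top.ne
  have hcont : Continuous fun s : ℝ => s ^ 2 := continuous_id.pow 2
  have hintS : IntegrableOn (fun s : ℝ => s ^ 2) S volume :=
    (hcont.continuousOn.integrableOn_compact isCompact_Icc).mono_set hSab
  have hintI : IntegrableOn (fun s : ℝ => s ^ 2) I volume := hcont.continuousOn.integrableOn_compact isCompact_Icc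
  -- split both integrals along `S ∩ I`
  have hsplitS := integral_inter_add_sdiff hIm hintS
  have hsplitI := integral_inter_add_sdiff hS hintI
  rw [inter_comm] at hsplitI
  -- measures: `vol(S \\ I) ≥ vol(I \\ S)`
  have hmS := measureReal_inter_add_sdiff (μ := volume) (s := S) hIm hSfin
  have hmI := measureReal_inter_add_sdiff (μ := volume) (s := I) hS hIfin
  rw [inter_comm] at hmI
  have hvolI : volume.real I = μ₀ := by rw [hI, Real.volume_real_Icc_of_le (by linarith)]; ring
  have hcmp : volume.real (I \ S) ≤ volume.real (S \ I) := by linarith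
  -- values: `s² ≤ (a+μ₀)²` on `I \\ S`, `s² ≥ (a+μ₀)²` on `S \\ I`
  have h1 : ∫ s in I \ S, s ^ 2 ≤ (a + μ₀) ^ 2 * volume.real (I \ S) := by
    have h := setIntegral_mono_on (hintI.mono_set sdiff_subset) (integrableOn_const (measure_ne_top_of_subset sdiff_subset hIfin))
      (hIm.diff hS) (fun s hs => ?_ : ∀ s ∈ I \ S, s ^ 2 ≤ (a + μ₀) ^ 2)
    · rwa [setIntegral_const, smul_eq_mul, mul_comm] at h
    · exact pow_le_pow_left₀ (ha.trans hs.1.1) hs.1.2 2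
  have h2 : (a + μ₀) ^ 2 * volume.real (S \ I) ≤ ∫ s in S \ I, s ^ 2 := by
    have h := setIntegral_mono_on (integrableOn_const (measure_ne_top_of_subset sdiff_subset hSfin))
      (hintS.mono_set sdiff_subset) (hS.diff hIm) (fun s hs => ?_ : ∀ s ∈ S \ I, (a + μ₀) ^ 2 ≤ s ^ 2)
    · rwa [setIntegral_const, smul_eq_mul, mul_comm] at h
    · have hsab := hSab hs.1
      have hnot : ¬ s ≤ a + μ₀ := fun hle => hs.2 ⟨hsab.1, hle⟩
      exact pow_le_pow_left₀ (by positivity) (not_le.1 hnot).le 2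
  have h3 : (a + μ₀) ^ 2 * volume.real (I \ S) ≤ (a + μ₀) ^ 2 * volume.real (S \ I) :=
    mul_le_mul_of_nonneg_left hcmp (sq_nonneg _)
  linarith

/-! ## The weighted quiet slice -/

/-- **(Q) THE `s²`-WEIGHTED QUIET SLICE.**  See the module docstring. [folklore (Markov, bathtub principle)] -/
theorem weightedQuietSlice_of {F G : EuclideanSpace ℝ (Fin 3) → ℝ} (hFc : Continuous F) (hGc : Continuous G)
    (hF0 : ∀ x, 0 ≤ F x) (hG0 : ∀ x, 0 ≤ G x) {R Λ R' η X Y : ℝ} (hR : 0 < R) (hΛ : 1 < Λ) (hη : 0 < η) (hη1 : η < 1)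
    (hX : 0 < X) (hY : 0 < Y)
    (hFX : ∫ x in ball (0 : EuclideanSpace ℝ (Fin 3)) R', F x ≤ X)
    (hGY : ∫ x in ball (0 : EuclideanSpace ℝ (Fin 3)) R', G x ≤ Y) :
    ∃ s ∈ Icc R (Λ * R),
      ∫ a, (ball (0 : EuclideanSpace ℝ (Fin 3)) R').indicator F (plane s a) ≤ X / (η * (Λ - 1) * R) ∧
      ∫ a, (ball (0 : EuclideanSpace ℝ (Fin 3)) R').indicator G (plane s a) ≤
        3 * Y / (((1 + (1 - η) * (Λ - 1)) ^ 3 - 1) * R ^ 3) * s ^ 2 := by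
  set hF : ℝ → ℝ := fun s => ∫ a, (ball (0 : EuclideanSpace ℝ (Fin 3)) R').indicator F (plane s a) with hhF
  set hG : ℝ → ℝ := fun s => ∫ a, (ball (0 : EuclideanSpace ℝ (Fin 3)) R').indicator G (plane s a) with hhG
  have hFint : Integrable hF := integrable_integral_plane _ (integrable_indicator_ball_of_continuous hFc R')
  have hGint : Integrable hG := integrable_integral_plane _ (integrable_indicator_ball_of_continuous hGc R')
  have hFnn : ∀ s, 0 ≤ hF s := fun s => integral_indicator_plane_nonneg hF0 R' s
  have hGnn : ∀ s, 0 ≤ hG s := fun s => integral_indicator_plane_nonneg hG0 R' s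
  have hFtot : ∫ s, hF s ≤ X := by rw [hhF, integral_integral_indicator_plane hFc R']; exact hFX
  have hGtot : ∫ s, hG s ≤ Y := by rw [hhG, integral_integral_indicator_plane hGc R']; exact hGY
  have hΛ1 : 0 < Λ - 1 := by linarith
  set μ₀ : ℝ := (1 - η) * (Λ - 1) * R with hμ₀
  have hμ₀pos : 0 < μ₀ := by rw [hμ₀]; exact mul_pos (mul_pos (by linarith) hΛ1) hR
  set tF : ℝ := X / (η * (Λ - 1) * R) with htF
  have htFpos : 0 < tF := by rw [htF]; positivity
  -- Markov for `F` on `[R, ΛR]`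
  set J : Set ℝ := Icc R (Λ * R) with hJ
  have hJm : MeasurableSet J := measurableSet_Icc
  have hJvol : volume.real J = (Λ - 1) * R := by
    rw [hJ, Real.volume_real_Icc_of_le (by nlinarith)]; ring
  have hBad : volume.real ({s | tF ≤ hF s} ∩ J) ≤ η * (Λ - 1) * R := by
    have hM := mul_meas_ge_le_integral_of_nonneg (μ := volume.restrict J) (ae_of_all _ hFnn) hFint.restrict tF
    have hset : ∫ s in J, hF s ≤ X := (setIntegral_le_integral hFint (ae_of_all _ hFnn)).trans hFtot
    rw [measureReal_restrict_apply' hJm] at hM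
    have hle : tF * volume.real ({s | tF ≤ hF s} ∩ J) ≤ X := hM.trans hset
    have e : X = tF * (η * (Λ - 1) * R) := by rw [htF]; field_simp
    rw [e] at hle
    exact le_of_mul_le_mul_left hle htFpos
  -- measurability of the slice functions
  have hmeas : ∀ {Φ : EuclideanSpace ℝ (Fin 3) → ℝ}, Continuous Φ →
      Measurable fun s => ∫ a, (ball (0 : EuclideanSpace ℝ (Fin 3)) R').indicator Φ (plane s a) := by
    intro Φ hΦ
    have hH : Measurable ((ball (0 : EuclideanSpace ℝ (Fin 3)) R').indicator Φ) := hΦ.measurable.indicator measurableSet_ball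
    have h1 : StronglyMeasurable (uncurry fun (s : ℝ) (a : EuclideanSpace ℝ (Fin 2)) =>
        (ball (0 : EuclideanSpace ℝ (Fin 3)) R').indicator Φ (plane s a)) := by
      have e : (uncurry fun (s : ℝ) (a : EuclideanSpace ℝ (Fin 2)) =>
          (ball (0 : EuclideanSpace ℝ (Fin 3)) R').indicator Φ (plane s a)) =
          fun p => (ball (0 : EuclideanSpace ℝ (Fin 3)) R').indicator Φ (planeEquiv.symm p) := by
        funext p; rw [uncurry, ← planeEquiv_symm_apply]
      rw [e]; exact (hH.comp planeEquiv.symm.measurable).stronglyMeasurable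
    exact (h1.integral_prod_right (ν := volume)).measurable
  have hFm : Measurable hF := hmeas hFc
  have hGm : Measurable hG := hmeas hGc
  -- the good set
  set S : Set ℝ := J ∩ {s | hF s < tF} with hSdef
  have hSm : MeasurableSet S := hJm.inter (measurableSet_lt hFm measurable_const)
  have hSJ : S ⊆ J := inter_subset_left
  have hJfin : volume J ≠ ⊤ := measure_Icc_lt_top.ne
  have hSvol : μ₀ ≤ volume.real S := by
    have hsplit := measureReal_inter_add_sdiff (μ := volume) (s := J) (t := {s | tF ≤ hF s})
      (measurableSet_le measurable_const hFm) hJfin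
    -- `J ∩ {tF ≤ hF} = {tF ≤ hF} ∩ J` and `J \ {tF ≤ hF} = S`
    have e1 : J ∩ {s | tF ≤ hF s} = {s | tF ≤ hF s} ∩ J := inter_comm _ _
    have e2 : J \ {s | tF ≤ hF s} = S := by
      ext s
      simp only [hSdef, Set.mem_sdiff, mem_inter_iff, mem_setOf_eq, not_le]
    rw [e1, e2, hJvol] at hsplit
    rw [hμ₀]
    nlinarith [hBad, hsplit]
  -- the `G`-threshold
  set lam : ℝ := 3 * Y / (((1 + (1 - η) * (Λ - 1)) ^ 3 - 1) * R ^ 3) with hlam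
  have hbase : 1 < 1 + (1 - η) * (Λ - 1) := by nlinarith
  have hden : 0 < ((1 + (1 - η) * (Λ - 1)) ^ 3 - 1) * R ^ 3 := by
    have : 1 < (1 + (1 - η) * (Λ - 1)) ^ 3 := by
      have h2 := pow_lt_pow_left₀ hbase zero_le_one (n := 3) (by norm_num)
      rwa [one_pow] at h2
    have : 0 < R ^ 3 := by positivity
    nlinarith
  have hlampos : 0 < lam := by rw [hlam]; positivity
  -- bathtub: `lam · ∫_S s² ≥ Y`
  have hbath := setIntegral_sq_ge_bathtub hR.le hμ₀pos.le hSm hSJ hSvol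
  have hIcc : ∫ s in Icc R (R + μ₀), s ^ 2 = ((R + μ₀) ^ 3 - R ^ 3) / 3 := by
    rw [integral_Icc_eq_integral_Ioc, ← intervalIntegral.integral_of_le (by linarith), integral_pow]; norm_num
  have hkey : Y ≤ lam * ∫ s in S, s ^ 2 := by
    have e : lam * (((R + μ₀) ^ 3 - R ^ 3) / 3) = Y := by
      have hden' := ne_of_gt hden
      rw [hlam, hμ₀]
      have e3 : (R + (1 - η) * (Λ - 1) * R) ^ 3 - R ^ 3 = (((1 + (1 - η) * (Λ - 1)) ^ 3 - 1) * R ^ 3) := by ring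
      rw [e3]
      have hb3 : (1 + (1 - η) * (Λ - 1)) ^ 3 - 1 ≠ 0 := by
        intro h0; rw [h0, zero_mul] at hden'; exact hden' rfl
      field_simp
    calc Y = lam * (((R + μ₀) ^ 3 - R ^ 3) / 3) := e.symm
      _ = lam * ∫ s in Icc R (R + μ₀), s ^ 2 := by rw [hIcc]
      _ ≤ lam * ∫ s in S, s ^ 2 := mul_le_mul_of_nonneg_left hbath hlampos.le
  -- conclusion by contradiction
  by_contra hcon
  push Not at hcon
  -- on `S`: `hG s > lam s²`
  have hstrict : ∀ s ∈ S, lam * s ^ 2 < hG s := by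
    intro s hs
    have hsJ : s ∈ Icc R (Λ * R) := hSJ hs
    have hFs : hF s ≤ tF := le_of_lt hs.2
    exact hcon s hsJ hFs
  have hi2 : IntegrableOn (fun s : ℝ => lam * s ^ 2) S volume :=
    ((continuous_const.mul (continuous_id.pow 2) : Continuous fun s : ℝ => lam * s ^ 2).continuousOn.integrableOn_compact
      isCompact_Icc).mono_set hSJ
  have hintS : IntegrableOn (fun s => hG s - lam * s ^ 2) S volume := (hGint.integrableOn).sub hi2
  have hpos : 0 < ∫ s in S, (hG s - lam * s ^ 2) := by
    rw [setIntegral_pos_iff_support_of_nonneg_ae ?_ hintS]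
    · have hSsub : S ⊆ support (fun s => hG s - lam * s ^ 2) ∩ S := fun s hs =>
        ⟨Function.mem_support.2 (ne_of_gt (sub_pos.2 (hstrict s hs))), hs⟩
      have hSpos : 0 < volume S := by
        have h := hSvol
        rw [measureReal_def] at h
        exact ENNReal.toReal_pos_iff.1 (hμ₀pos.trans_le h) |>.1
      exact hSpos.trans_le (measure_mono hSsub)
    · filter_upwards [ae_restrict_mem hSm] with s hs
      exact (sub_pos.2 (hstrict s hs)).le
  have hsplit : ∫ s in S, (hG s - lam * s ^ 2) = (∫ s in S, hG s) - lam * ∫ s in S, s ^ 2 := by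
    rw [integral_sub hGint.integrableOn hi2, integral_const_mul]
  have hGS : ∫ s in S, hG s ≤ Y := (setIntegral_le_integral hGint (ae_of_all _ hGnn)).trans hGtot
  rw [hsplit] at hpos
  linarith

/-- **`NsregP2.R45.WeightedQuietSlice`, binder-for-binder** (Sketch45 of nsreg-p2 g35, plate t47-Q; `E3` spelled out, `plane` =
`Condenser.plane`). [folklore (Markov, bathtub principle)] -/
theorem weightedQuietSlice :
    ∀ (F G : EuclideanSpace ℝ (Fin 3) → ℝ), Continuous F → Continuous G → (∀ x, 0 ≤ F x) → (∀ x, 0 ≤ G x) →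
      ∀ (R Λ R' η X Y : ℝ), 0 < R → 1 < Λ → 0 < η → η < 1 → 0 < X → 0 < Y →
        (∫ x in ball (0 : EuclideanSpace ℝ (Fin 3)) R', F x ≤ X) → (∫ x in ball (0 : EuclideanSpace ℝ (Fin 3)) R', G x ≤ Y) →
        ∃ s ∈ Icc R (Λ * R),
          ∫ a, (ball (0 : EuclideanSpace ℝ (Fin 3)) R').indicator F (plane s a) ≤ X / (η * (Λ - 1) * R) ∧
          ∫ a, (ball (0 : EuclideanSpace ℝ (Fin 3)) R').indicator G (plane s a) ≤
            3 * Y / (((1 + (1 - η) * (Λ - 1)) ^ 3 - 1) * R ^ 3) * s ^ 2 :=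
  fun _ _ hFc hGc hF0 hG0 _ _ _ _ _ _ hR hΛ hη hη1 hX hY hFX hGY =>
    weightedQuietSlice_of hFc hGc hF0 hG0 hR hΛ hη hη1 hX hY hFX hGY

end Summit.NavierStokesRegularity.NavierStokesRegularity.Theorems.PowerGaugeEulerLiouville.Condenser

end
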